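import Summits.HodgeConjecture.HodgeConjecture.Theorems.VHCAbelianSchemesRoadOneNonJumpingPointOfInputsPlus
import HarnessLib

/-!
# Road №4 (`VHCAbelianSchemesRoad`), crux stmt-HodgeConjecture-26512 `DiagLocalOfMarkmanPinnedForall` — route «2T»: the PAIRWISE-FULL sibling (#3) of the upstairs socket
# over `D⁺`: `Φ` shift-commuting and SURJECTIVE ON THE TWO HOM-SETS IT IS USED ON — no global `Full` ∕ `Faithful`

research route conditional on HC_CM; not a corollary; Q11.4-sentence-2 already refuted in dim ≥ 3.

Seat core-w5 g7 (claim-free; `--supports stmt-HodgeConjecture-26512 --as helper`; 0 new facts; LEAD 167's price «SOCKET #3 PAIRWISE-FULL» in the answer to director-hodge g19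
R19.11 (3); sockets #1 `…OneNonJumpingPointOfInputs.lean` and #2 `…OneNonJumpingPointOfInputsPlus.lean` UNTOUCHED, #2 imported). WHY: in sockets #1 ∕ #2 the functor binder carries
`[Φ.Full] [Φ.Faithful]`; the Φ-step consumes only the SURJECTIVITY of `Φ.map` on the Hom-sets `Hom(X₁, X₂⟦k⟧)` of the two box objects (plus `Φ.commShiftIso`), and GLOBAL fullness of a
Fourier–Mukai-type functor on `D⁺` of ALL `𝒪`-modules is not a statement print proves (Mukai 1981 Thm. 2.2 is on `D^b(Coh)`; Mukai 1987 Thm. 1.1 relative; Huybrechts Prop. 9.19), whereas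
the PAIRWISE statement on two bounded vector-bundle complexes is print's own. So this file re-proves socket #2's three theorems with the functor binder
`∀ (Φ : DerivedCategory.Plus _ ⥤ DerivedCategory.Plus _) [Φ.CommShift ℤ] (hΦ : ∀ k : ℤ, Function.Surjective (Φ.map : (X₁ ⟶ X₂⟦k⟧) → (Φ.obj X₁ ⟶ Φ.obj (X₂⟦k⟧))))`
(`Xᵢ = ⟨Q(Rᵢ• ⊠ Sᵢ•), plus_Q_boxTensorComplex …⟩` the box objects of socket #2) in place of `[Φ.CommShift ℤ] [Φ.Full] [Φ.Faithful]`; everything else — data binders, the two isomorphisms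
through `DerivedCategory.Plus.ι`, the named fact `KunnethFormulaExt` (the only one), (vi), the downstairs conclusions — is IDENTICAL to socket #2.

* §1 `subsingleton_hom_shift_of_map_surjective` — the generic transport: `Φ` shift-commuting, `Φ.map` surjective on `Hom(A, B⟦n⟧)`, `Hom(A, B⟦n⟧)` subsingleton ⟹
  `Hom(ΦA, (ΦB)⟦n⟧)` subsingleton (the surjective half of the venture's `Summit.Ventures.HSemireg.subsingleton_hom_shift_iff`); **`not_mem_extJumpLocus_of_pairwiseFull_boxIsos_plus`**.
* §2 **`not_mem_extJumpLocus_quotientPullback_of_twoTorsion_inputs_pairwiseFullPlus'`**, **`oneNonJumpingPoint_of_inputs_pairwiseFullPlus'`**.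

COSTUME (verbatim R19.5 ∕ R19.11): (N-U♭)'s BODY FROM INPUTS over `D⁺` — never (N-U♭) ∕ (N-U); STATUS-only; a «socket of record» only on the director's word after the critic's kernel
plate. WEAKER HYPOTHESIS, SAME CONCLUSION: socket #2 follows from this file (a full functor is surjective on every Hom-set), not conversely. No stub is stated, restated or weakened;
nothing touches `closes`, the skeleton or any stub. NOTHING here says (N-U♭), (N-U), (S4), the crux, №4, HC_AV, HC_CM or HC holds; HC_CM HELD, by name only; helper lane (width 0).
References: [cite: Markman2025SecantWeil, §9.3 Rem. 9.3.7, Lemma 9.3.5, Lemma 9.3.11; p. 52] [cite: Mukai1981, Thm. 2.2 and (3.1)] [cite: HuybrechtsFM2006, Prop. 9.19]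
[cite: StacksProject, Tag 0FXZ] [cite: Orlov2002DerivedAbelian, p. 3 L33–40].
-/

noncomputable section

-- `TopCat.Presheaf`/`Scheme.Modules` are not reducible (as in Mathlib's `AlgebraicGeometry/Modules/Sheaf.lean`).
set_option backward.isDefEq.respectTransparency false

open CategoryTheory CategoryTheory.Category CategoryTheory.Limits AlgebraicGeometry

namespace Summit.HodgeConjecture.HodgeConjecture.Ring2.SemiregularRepresentatives

set_option linter.dupNamespace false -- the cell's namespace repeats the summit name, as in every `Ring2*` file

namespace NowhereDisplaceable

open Literature.AlgebraicGeometry Literature.AlgebraicGeometry.Motives Literature.AlgebraicGeometry.Motives.AbelianVariety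
open Literature.AlgebraicGeometry.Modules Literature.AlgebraicGeometry.HodgeTheory Literature.AlgebraicGeometry.KTheory
open Summit.HodgeConjecture.HodgeConjecture.Ring2.SemiregularRepresentatives.MoverTrap

/-! ## §1 The surjective transport of Hom-set vanishing, and the Φ-step over `D⁺` with pairwise fullness -/

/-- **Transport of `Hom`-vanishing along a functor that is surjective on ONE Hom-set**: for a functor `Φ` commuting with the shifts by `ℤ`, if
`Φ.map : Hom(A, B⟦n⟧) → Hom(ΦA, Φ(B⟦n⟧))` is surjective and `Hom(A, B⟦n⟧)` has at most one element, then so has `Hom(ΦA, (ΦB)⟦n⟧)` (through `Φ.commShiftIso n`). The surjective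
half of `Summit.Ventures.HSemireg.subsingleton_hom_shift_iff` (which packages `Full` + `Faithful`); faithfulness is not needed in this direction. [cite: Orlov2002DerivedAbelian, p. 3 L33–40]
[cite: Mukai1981, Thm. 2.2 and Cor. 2.5] -/
theorem subsingleton_hom_shift_of_map_surjective {C : Type*} [Category C] {D' : Type*} [Category D'] [HasShift C ℤ] [HasShift D' ℤ] (Φ : C ⥤ D') [Φ.CommShift ℤ]
    (A B : C) (n : ℤ) (hΦ : Function.Surjective (Φ.map : (A ⟶ B⟦n⟧) → (Φ.obj A ⟶ Φ.obj (B⟦n⟧)))) (h : Subsingleton (A ⟶ B⟦n⟧)) :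
    Subsingleton (Φ.obj A ⟶ (Φ.obj B)⟦n⟧) := by
  haveI : Subsingleton (Φ.obj A ⟶ Φ.obj (B⟦n⟧)) := ⟨fun f g => by
    obtain ⟨f', rfl⟩ := hΦ f
    obtain ⟨g', rfl⟩ := hΦ g
    rw [Subsingleton.elim f' g']⟩
  exact ((Iso.refl (Φ.obj A)).homCongr ((Φ.commShiftIso n).app B)).subsingleton_congr.mp this

/-- **Steps (iii)–(vi) through a shift-commuting `Φ` ON `D⁺` that is FULL ON THE TWO BOX OBJECTS** (sibling #3 of `not_mem_extJumpLocus_of_fullyFaithful_boxIsos` ∕ `…_plus`): on `P`, a complex `𝓔` and a point `z`; on `A × B`,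
strictly perfect resolutions `Rᵢ•` (on `A`), `Sᵢ•` (of `Hᵢ` on `B`) with `Ext^{≥0}_B(H₁, H₂) = 0`; a shift-commuting `Φ : D⁺(Mod_{A×B}) ⥤ D⁺(Mod_P)`, surjective on `Hom(X₁, X₂⟦k⟧)` for all `k` (`Xᵢ` the two box objects), with, in
`D(Mod_P)`, `ι Φ⟨Q(R₁• ⊠ S₁•)⟩ ≅ Q(τ_z^*•𝓔)` and `ι Φ⟨Q(R₂• ⊠ S₂•)⟩ ≅ Q 𝓔` (`ι = DerivedCategory.Plus.ι`) ⟹ `z ∉ J(𝓔)`. CONDITIONAL on `KunnethFormulaExt`. The Hom sets move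
along `Plus.ι` (`subsingleton_hom_shift_iff`), across `Φ` (`subsingleton_hom_shift_of_map_surjective`), and down along `Plus.ι`. [cite: Mukai1981, Thm. 2.2 and (3.1)] [cite: StacksProject, Tag 0FXZ]
[cite: Markman2025SecantWeil, §9.3 Lemma 9.3.3 and p. 52] [cite: Orlov2002DerivedAbelian, p. 3 L33–40] -/
theorem not_mem_extJumpLocus_of_pairwiseFull_boxIsos_plus (hK : KunnethFormulaExt) (A B P : AbelianVariety ℂ) (𝓔 : CochainComplex P.X.left.Modules ℤ)
    (z : P.Points ℂ) {G₁ G₂ : A.X.left.Modules} (R₁ : StrictlyPerfectResolution G₁) (R₂ : StrictlyPerfectResolution G₂)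
    {H₁ H₂ : B.X.left.Modules} (S₁ : StrictlyPerfectResolution H₁) (S₂ : StrictlyPerfectResolution H₂)
    (hvi : ∀ j : ℕ, letI := HasDerivedCategory.standard B.X.left.Modules
      Subsingleton (ShiftedHom (DerivedCategory.Q.obj ((CochainComplex.singleFunctor B.X.left.Modules 0).obj H₁))
        (DerivedCategory.Q.obj ((CochainComplex.singleFunctor B.X.left.Modules 0).obj H₂)) (j : ℤ))) :
    letI := HasDerivedCategory.standard (A.prod B).X.left.Modules
    letI := HasDerivedCategory.standard P.X.left.Modules
    ∀ (Φ : DerivedCategory.Plus (A.prod B).X.left.Modules ⥤ DerivedCategory.Plus P.X.left.Modules) [Φ.CommShift ℤ]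
      (_ : ∀ k : ℤ, Function.Surjective (Φ.map :
        ((⟨DerivedCategory.Q.obj (A.boxTensorComplex B R₁.P S₁.P), plus_Q_boxTensorComplex A B R₁ S₁⟩ : DerivedCategory.Plus (A.prod B).X.left.Modules) ⟶
          (⟨DerivedCategory.Q.obj (A.boxTensorComplex B R₂.P S₂.P), plus_Q_boxTensorComplex A B R₂ S₂⟩ : DerivedCategory.Plus (A.prod B).X.left.Modules)⟦k⟧) → _))
      (_ : DerivedCategory.Plus.ι.obj (Φ.obj ⟨DerivedCategory.Q.obj (A.boxTensorComplex B R₁.P S₁.P), plus_Q_boxTensorComplex A B R₁ S₁⟩) ≅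
        DerivedCategory.Q.obj (translationPullbackComplex P z 𝓔))
      (_ : DerivedCategory.Plus.ι.obj (Φ.obj ⟨DerivedCategory.Q.obj (A.boxTensorComplex B R₂.P S₂.P), plus_Q_boxTensorComplex A B R₂ S₂⟩) ≅
        DerivedCategory.Q.obj 𝓔),
      z ∉ extJumpLocus P 𝓔 := by
  letI := HasDerivedCategory.standard (A.prod B).X.left.Modules
  letI := HasDerivedCategory.standard P.X.left.Modules
  intro Φ _ hΦ e₁ e₂
  simp only [extJumpLocus, Set.mem_setOf_eq, not_exists, not_not]
  intro k
  have h := subsingleton_shiftedHom_boxTensor_resolutions_both_of_right A B hK R₁ R₂ S₁ S₂ hvi k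
  -- up into `D⁺(Mod_{A×B})` along the fully faithful, shift-commuting inclusion `Plus.ι`
  have h₁ : Subsingleton
      ((⟨DerivedCategory.Q.obj (A.boxTensorComplex B R₁.P S₁.P), plus_Q_boxTensorComplex A B R₁ S₁⟩ :
          DerivedCategory.Plus (A.prod B).X.left.Modules) ⟶
        (⟨DerivedCategory.Q.obj (A.boxTensorComplex B R₂.P S₂.P), plus_Q_boxTensorComplex A B R₂ S₂⟩ :
          DerivedCategory.Plus (A.prod B).X.left.Modules)⟦k⟧) :=
    (Summit.Ventures.HSemireg.subsingleton_hom_shift_iff DerivedCategory.Plus.ι _ _ k).mp h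
  -- across `Φ` (surjectivity on this one Hom-set), then back down to `D(Mod_P)` along `Plus.ι`
  have h₂ := subsingleton_hom_shift_of_map_surjective Φ _ _ k (hΦ k) h₁
  have h₃ := (Summit.Ventures.HSemireg.subsingleton_hom_shift_iff DerivedCategory.Plus.ι _ _ k).mpr h₂
  exact (e₁.homCongr ((shiftFunctor _ k).mapIso e₂)).subsingleton_congr.mp h₃

/-! ## §2 On `P = J × Ĵ` of a secant–quotient datum, `Φ` on `D⁺` full on the two box objects: `p ∉ J(q^*E•)` and the literal (N-U♭) packaging -/

/-- **ROUTE 2T, THE UPSTAIRS SOCKET OVER `D⁺` WITH PAIRWISE FULLNESS, `KunnethFormulaExt` the ONLY named fact** (sibling #3 of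
`not_mem_extJumpLocus_quotientPullback_of_twoTorsion_inputs_fullyFaithful'` ∕ `…fullyFaithfulPlus'`): DATA — the datum `D`, `E•` on `Y`, the bounded VB complex `𝓔` on `P` with the descent quasi-iso
`f : q^*E• ⟶ (L^{⊗a})^∨ ⊗ 𝓔` (`a` even, `L` rank one), `p ∈ P[2](ℂ)`, resolutions `Rᵢ•`, `Sᵢ•` on `A`, `B`, the shift-commuting functor `Φ : D⁺(Mod_{A×B}) ⥤ D⁺(Mod_P)`, surjective on `Hom(X₁, X₂⟦k⟧)` for the two box objects and all
`k`, with the two isomorphisms in `D(P)` through `Plus.ι`; THE ONE MATHEMATICAL HYPOTHESIS (vi) `Ext^{≥0}_B(H₁, H₂) = 0` ⟹ `p ∉ J(q^*E•)`.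
[cite: Markman2025SecantWeil, §9.3 Rem. 9.3.7 and Lemma 9.3.5; p. 52] [cite: Mukai1981, Thm. 2.2 and (3.1)] [cite: StacksProject, Tag 0FXZ] -/
theorem not_mem_extJumpLocus_quotientPullback_of_twoTorsion_inputs_pairwiseFullPlus' (hK : KunnethFormulaExt)
    (D : SecantQuotientDatum) (E : CochainComplex D.Y.X.left.Modules ℤ) (𝓔 : CochainComplex D.P.X.left.Modules ℤ) (h𝓔vb : IsBoundedVBComplex 𝓔)
    {L : D.P.X.left.Modules} (hL : HasRank L 1) {a : ℕ} (ha : Even a)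
    (f : haveI := preservesZeroMorphisms_tensorBifunctor_obj (Modules.dual (tensorPow L a))
      quotientPullbackComplex D E ⟶ (((tensorBifunctor D.P.X.left).obj (Modules.dual (tensorPow L a))).mapHomologicalComplex (ComplexShape.up ℤ)).obj 𝓔)
    (hf : haveI := preservesZeroMorphisms_tensorBifunctor_obj (Modules.dual (tensorPow L a)); QuasiIso f)
    {p : D.P.Points ℂ} (hp : p ∈ D.P.torsionPoints ℂ 2) (A B : AbelianVariety ℂ)
    {G₁ G₂ : A.X.left.Modules} (R₁ : StrictlyPerfectResolution G₁) (R₂ : StrictlyPerfectResolution G₂)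
    {H₁ H₂ : B.X.left.Modules} (S₁ : StrictlyPerfectResolution H₁) (S₂ : StrictlyPerfectResolution H₂)
    (hvi : ∀ j : ℕ, letI := HasDerivedCategory.standard B.X.left.Modules
      Subsingleton (ShiftedHom (DerivedCategory.Q.obj ((CochainComplex.singleFunctor B.X.left.Modules 0).obj H₁))
        (DerivedCategory.Q.obj ((CochainComplex.singleFunctor B.X.left.Modules 0).obj H₂)) (j : ℤ))) :
    letI := HasDerivedCategory.standard (A.prod B).X.left.Modules
    letI := HasDerivedCategory.standard D.P.X.left.Modules
    ∀ (Φ : DerivedCategory.Plus (A.prod B).X.left.Modules ⥤ DerivedCategory.Plus D.P.X.left.Modules) [Φ.CommShift ℤ]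
      (_ : ∀ k : ℤ, Function.Surjective (Φ.map :
        ((⟨DerivedCategory.Q.obj (A.boxTensorComplex B R₁.P S₁.P), plus_Q_boxTensorComplex A B R₁ S₁⟩ : DerivedCategory.Plus (A.prod B).X.left.Modules) ⟶
          (⟨DerivedCategory.Q.obj (A.boxTensorComplex B R₂.P S₂.P), plus_Q_boxTensorComplex A B R₂ S₂⟩ : DerivedCategory.Plus (A.prod B).X.left.Modules)⟦k⟧) → _))
      (_ : DerivedCategory.Plus.ι.obj (Φ.obj ⟨DerivedCategory.Q.obj (A.boxTensorComplex B R₁.P S₁.P), plus_Q_boxTensorComplex A B R₁ S₁⟩) ≅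
        DerivedCategory.Q.obj (translationPullbackComplex D.P p 𝓔))
      (_ : DerivedCategory.Plus.ι.obj (Φ.obj ⟨DerivedCategory.Q.obj (A.boxTensorComplex B R₂.P S₂.P), plus_Q_boxTensorComplex A B R₂ S₂⟩) ≅
        DerivedCategory.Q.obj 𝓔),
      p ∉ extJumpLocus D.P (quotientPullbackComplex D E) := by
  intro Φ _ hΦ e₁ e₂
  exact not_mem_extJumpLocus_quotientPullback_of_quasiIso_dualTensorPow_twist LocallyFreeRankOneIsInvertible_holds D E hL ha hp 𝓔 h𝓔vb f hf
    (not_mem_extJumpLocus_of_pairwiseFull_boxIsos_plus hK A B D.P 𝓔 p R₁ R₂ S₁ S₂ hvi Φ hΦ e₁ e₂)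

/-- **The literal (N-U♭) packaging over `D⁺` with pairwise fullness, `KunnethFormulaExt` the ONLY named fact** (sibling #3 of `oneNonJumpingPoint_of_inputs_fullyFaithful'`): from an (O₁)-datum `(γ, 𝓓)`
at `(D, θ₀)` whose carrier `𝓓.E` comes with the DATA above (through `Φ` on `D⁺`, full on the two box objects), `∃ γ ∈ served, ∃ 𝓓, ∃ p, p ∉ J(q^*𝓓.E)`. [cite: Markman2025SecantWeil, §9.3 Lemma 9.3.11 and Rem. 9.3.7]
[cite: Mukai1981, Thm. 2.2 and (3.1)] [cite: StacksProject, Tag 0FXZ] -/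
theorem oneNonJumpingPoint_of_inputs_pairwiseFullPlus' (hK : KunnethFormulaExt) (C : ChernCharacterBetti)
    (D : SecantQuotientDatum) (θ₀ : complexBetti D.𝒥.J.X 2) {γ : complexBetti D.Y.X (2 * 3)} (hγ : γ ∈ secantQuotientServedClassesPinned D.Y.X (D.hY θ₀))
    (𝓓 : PinnedTwistedDatum C AdmTw' D.Y.X (D.hY θ₀) γ) (𝓔 : CochainComplex D.P.X.left.Modules ℤ) (h𝓔vb : IsBoundedVBComplex 𝓔)
    {L : D.P.X.left.Modules} (hL : HasRank L 1) {a : ℕ} (ha : Even a)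
    (f : haveI := preservesZeroMorphisms_tensorBifunctor_obj (Modules.dual (tensorPow L a))
      quotientPullbackComplex D 𝓓.E ⟶ (((tensorBifunctor D.P.X.left).obj (Modules.dual (tensorPow L a))).mapHomologicalComplex (ComplexShape.up ℤ)).obj 𝓔)
    (hf : haveI := preservesZeroMorphisms_tensorBifunctor_obj (Modules.dual (tensorPow L a)); QuasiIso f)
    {p : D.P.Points ℂ} (hp : p ∈ D.P.torsionPoints ℂ 2) (A B : AbelianVariety ℂ)
    {G₁ G₂ : A.X.left.Modules} (R₁ : StrictlyPerfectResolution G₁) (R₂ : StrictlyPerfectResolution G₂)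
    {H₁ H₂ : B.X.left.Modules} (S₁ : StrictlyPerfectResolution H₁) (S₂ : StrictlyPerfectResolution H₂)
    (hvi : ∀ j : ℕ, letI := HasDerivedCategory.standard B.X.left.Modules
      Subsingleton (ShiftedHom (DerivedCategory.Q.obj ((CochainComplex.singleFunctor B.X.left.Modules 0).obj H₁))
        (DerivedCategory.Q.obj ((CochainComplex.singleFunctor B.X.left.Modules 0).obj H₂)) (j : ℤ))) :
    letI := HasDerivedCategory.standard (A.prod B).X.left.Modules
    letI := HasDerivedCategory.standard D.P.X.left.Modules
    ∀ (Φ : DerivedCategory.Plus (A.prod B).X.left.Modules ⥤ DerivedCategory.Plus D.P.X.left.Modules) [Φ.CommShift ℤ]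
      (_ : ∀ k : ℤ, Function.Surjective (Φ.map :
        ((⟨DerivedCategory.Q.obj (A.boxTensorComplex B R₁.P S₁.P), plus_Q_boxTensorComplex A B R₁ S₁⟩ : DerivedCategory.Plus (A.prod B).X.left.Modules) ⟶
          (⟨DerivedCategory.Q.obj (A.boxTensorComplex B R₂.P S₂.P), plus_Q_boxTensorComplex A B R₂ S₂⟩ : DerivedCategory.Plus (A.prod B).X.left.Modules)⟦k⟧) → _))
      (_ : DerivedCategory.Plus.ι.obj (Φ.obj ⟨DerivedCategory.Q.obj (A.boxTensorComplex B R₁.P S₁.P), plus_Q_boxTensorComplex A B R₁ S₁⟩) ≅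
        DerivedCategory.Q.obj (translationPullbackComplex D.P p 𝓔))
      (_ : DerivedCategory.Plus.ι.obj (Φ.obj ⟨DerivedCategory.Q.obj (A.boxTensorComplex B R₂.P S₂.P), plus_Q_boxTensorComplex A B R₂ S₂⟩) ≅
        DerivedCategory.Q.obj 𝓔),
      ∃ γ ∈ secantQuotientServedClassesPinned D.Y.X (D.hY θ₀), ∃ 𝓓 : PinnedTwistedDatum C AdmTw' D.Y.X (D.hY θ₀) γ, ∃ p : D.P.Points ℂ,
        p ∉ extJumpLocus D.P (quotientPullbackComplex D 𝓓.E) := by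
  intro Φ _ hΦ e₁ e₂
  exact ⟨γ, hγ, 𝓓, p, not_mem_extJumpLocus_quotientPullback_of_twoTorsion_inputs_pairwiseFullPlus' hK D 𝓓.E 𝓔 h𝓔vb hL ha f hf hp A B R₁ R₂ S₁ S₂
    hvi Φ hΦ e₁ e₂⟩

end NowhereDisplaceable

end Summit.HodgeConjecture.HodgeConjecture.Ring2.SemiregularRepresentatives

end
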